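import Summits.Parity.GeneralizedHardyLittlewood.Theorems.PrimeLevelFamEdgeMomentsBeyondDiagonalDiagRemEstimate
import Summits.Parity.GeneralizedHardyLittlewood.Theorems.PrimeLevelFamEdgeMomentsBeyondDiagonalDiagOrderDegree
import Summits.Parity.GeneralizedHardyLittlewood.Theorems.PrimeLevelFamEdgeMomentsBeyondDiagonalDiagOrderSelberg
import HarnessLib

/-!
# Route `PrimeLevelFamEdge`, crux K_A `MomentsBeyondDiagonal` (stmt-Parity-20007), line «petersson_layers» v4, stub `stub_diag`:
# **RUNG `N = 1` OF THE GRADED ASSEMBLY IS UNCONDITIONAL — the diagonal main term for every `Q` of degree `≤ 1`**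

`…DiagOrderDegree.diagPart_asymp_of_orderAsymptotics_le` (p821905) grades the reduction of `stub_diag : SubDiag` by the degree
of `Q`: rung `N` needs the per-order targets with `i, j ≤ N`. Rung `0` was closed there; rung `1` needs in addition only the
order `(1,1)` (the orders `(0,1)`, `(1,0)` have odd `i+j`), which is `…DiagRemEstimate.orderOneOne_target` (this generation).

* `diagPart_asymp_of_selbergOrderAsymptotics_le` — the graded assembly with the per-order targets in the REAL decorated
  Selberg coordinates of `…DiagOrderSelberg` (the input form of the `…DiagDecor*` engines), any rung `N`;
* `diagPart_asymp_of_natDegree_le_one` — **rung `N = 1`, unconditional: for every admissible `P`, every `Q` with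
  `deg Q ≤ 1` and every `Δ' ∈ (1, 3/2]` there are `C, q₀` with
  `‖diagPart q P Q Δ' − 2ζ(2)² q̂/(Δ'²ℓ²)·(Q₀²·secondMomentForm Δ' P 1 + 2Q₁²·τ₁₁(Δ',P))‖ ≤ C q̂ ℓ⁻³` for `q ≥ q₀`**,
  `τ₁₁ = Δ′²K₀/(2(π²/6)²)`, `K₀ = (π²/6)²(Φ₃(1/Δ′,P)/24 − Ψ₁(1/Δ′,P)/4)` (closed form of `…DiagDecorOrderOneOnePoly`).

Def-free; helper `--supports stmt-Parity-20007`; closes nothing (`stub_diag` needs every order `(i,j)`, `i+j` even; the orders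
with `max(i,j) ≥ 2` remain, as do `stub_rung/core/band/identP`); K_A, K_B and the Parity summit are NOT proved; nothing about
Landau–Siegel zeros.

## References
* E. Kowalski, P. Michel, J. VanderKam, J. reine angew. Math. 526 (2000), (23)–(28) pp. 13–15, Prop. 5.1 (31) p. 18.
  [cite: KowalskiMichelVanderKam2000, (23)–(28) pp. 13–15 — derivation (diagonal main term, Q of degree ≤ 1)]
-/

noncomputable section

open scoped Real ArithmeticFunction.Moebius
open Complex MeasureTheory Polynomial Finset ArithmeticFunction
open Literature.NumberTheory.LFunctions

namespace Summit.Parity.GeneralizedHardyLittlewood.Theorems.MomentsBeyondDiagonal.DiagLines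

open Summit.Parity.GeneralizedHardyLittlewood.Theorems.PrimeLevelFamEdgeIdeaDeltas.PeterssonLayers
  (diagPart HasShape SubOf SubDiag)
open Summit.Parity.GeneralizedHardyLittlewood.Theorems.MomentsBeyondDiagonal.DiagCorner (orderOneOne_target)

/-- **The GRADED assembly with the per-order targets in real decorated Selberg coordinates** (rung `N`: orders `i, j ≤ N`,
`i+j` even, `(i,j) ≠ (0,0)`; `τ₀₀ = secondMomentForm Δ' P 1 / 2`; `Δ ≤ 3/2`).
[cite: KowalskiMichelVanderKam2000, (23)–(28) pp. 13–15 — derivation] -/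
theorem diagPart_asymp_of_selbergOrderAsymptotics_le {Δ : ℝ} (hΔ : Δ ≤ 3 / 2) (N : ℕ) (τ : ℕ → ℕ → ℝ → ℝ[X] → ℝ)
    (h0 : ∀ (Δ' : ℝ) (P : ℝ[X]), τ 0 0 Δ' P = KMV2000.secondMomentForm Δ' P 1 / 2)
    (h : ∀ i j : ℕ, i ≤ N → j ≤ N → Even (i + j) → ¬(i = 0 ∧ j = 0) → ∀ P : ℝ[X], KMV2000.Admissible P → ∀ Δ' : ℝ, 1 < Δ' → Δ' ≤ Δ →
      ∃ C : ℝ, ∃ q₀ : ℕ, ∀ (q : ℕ) [NeZero q], q₀ ≤ q →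
        |(Real.log (KMV2000.qhat q))⁻¹ ^ (i + j) * KMV2000.qhat q *
          (∑ c ∈ Icc 1 ⌊KMV2000.qhat q ^ Δ'⌋₊, ∑ g ∈ Icc 1 (⌊KMV2000.qhat q ^ Δ'⌋₊ / c), (μ g : ℝ) * c *
            ∑ k₁ ∈ Icc 1 (⌊KMV2000.qhat q ^ Δ'⌋₊ / (c * g)), ∑ k₂ ∈ Icc 1 (⌊KMV2000.qhat q ^ Δ'⌋₊ / (c * g)),
              ((μ (c * g * k₁) : ℝ) * ((KMV2000.psi (c * g * k₁))⁻¹ *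
                  P.eval (Real.log (KMV2000.qhat q ^ Δ' / ((c * g * k₁ : ℕ) : ℝ)) / Real.log (KMV2000.qhat q ^ Δ'))) /
                  ((c * g * k₁ : ℕ) : ℝ)) *
              ((μ (c * g * k₂) : ℝ) * ((KMV2000.psi (c * g * k₂))⁻¹ *
                  P.eval (Real.log (KMV2000.qhat q ^ Δ' / ((c * g * k₂ : ℕ) : ℝ)) / Real.log (KMV2000.qhat q ^ Δ'))) /
                  ((c * g * k₂ : ℕ) : ℝ)) *
              ∑ d ∈ k₁.divisors, ∑ e ∈ k₂.divisors,
                ∫ u₁ in Set.Ioi (0 : ℝ),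
                  (Real.log (KMV2000.qhat q / ((k₁ / d * (g * e) : ℕ) : ℝ)) + Real.log u₁) ^ i *
                  ∫ u₂ in Set.Ioi ((((k₁ / d * (g * e) * (g * d * (k₂ / e)) : ℕ) : ℝ) / KMV2000.qhat q ^ 2) / u₁),
                    Real.exp (-(u₁ + u₂)) / (1 - Real.exp (-(u₁ + u₂))) ^ 2 *
                    (Real.log (KMV2000.qhat q / ((g * d * (k₂ / e) : ℕ) : ℝ)) + Real.log u₂) ^ j) -
          2 * (π ^ 2 / 6) ^ 2 * (KMV2000.qhat q / (Δ' ^ 2 * Real.log (KMV2000.qhat q) ^ 2)) * τ i j Δ' P| ≤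
          C * KMV2000.qhat q * (Real.log (KMV2000.qhat q))⁻¹ ^ 3)
    {P Q : ℝ[X]} (hP : KMV2000.Admissible P) (hQ : Q.natDegree ≤ N) {Δ' : ℝ} (h1 : 1 < Δ') (h2 : Δ' ≤ Δ) :
    ∃ C : ℝ, ∃ q₀ : ℕ, ∀ (q : ℕ) [NeZero q], q₀ ≤ q →
      ‖diagPart q P Q Δ' -
          ((2 * riemannZeta 2 ^ 2 *
              ((KMV2000.qhat q / (Δ' ^ 2 * Real.log (KMV2000.qhat q) ^ 2) : ℝ) : ℂ)) *
            (((∑ i ∈ Finset.range (Q.natDegree + 1), ∑ j ∈ Finset.range (Q.natDegree + 1),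
              Q.coeff i * Q.coeff j * (1 + (-1 : ℝ) ^ (i + j)) * τ i j Δ' P : ℝ)) : ℂ))‖ ≤
        C * KMV2000.qhat q * (Real.log (KMV2000.qhat q))⁻¹ ^ 3 := by
  refine diagPart_asymp_of_orderAsymptotics_le hΔ N τ h0 ?_ hP hQ h1 h2
  intro i j hi hj hij h00 P hP Δ' h1 h2
  obtain ⟨C, q₀, hC⟩ := h i j hi hj hij h00 P hP Δ' h1 h2
  refine ⟨C, q₀, fun q _ hq ↦ ?_⟩
  have hq' := hC q hq
  -- the inner sum in decorated Selberg coordinates (real identity)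
  have key := sum_mollifierCoeff_hecke_eq_decorated P (KMV2000.qhat q ^ Δ') ⌊KMV2000.qhat q ^ Δ'⌋₊
    (fun n₁ n₂ K ↦ ∫ u₁ in Set.Ioi (0 : ℝ), (Real.log (KMV2000.qhat q / (n₁ : ℝ)) + Real.log u₁) ^ i *
      ∫ u₂ in Set.Ioi (((K : ℕ) : ℝ) / KMV2000.qhat q ^ 2 / u₁),
        Real.exp (-(u₁ + u₂)) / (1 - Real.exp (-(u₁ + u₂))) ^ 2 *
          (Real.log (KMV2000.qhat q / (n₂ : ℝ)) + Real.log u₂) ^ j)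
  -- the complex expression is the cast of the real one
  have hcast : (((Real.log (KMV2000.qhat q))⁻¹ : ℝ) : ℂ) ^ (i + j) * (KMV2000.qhat q : ℂ) *
          ∑ m₁ ∈ Finset.Icc 1 ⌊KMV2000.qhat q ^ Δ'⌋₊, ∑ m₂ ∈ Finset.Icc 1 ⌊KMV2000.qhat q ^ Δ'⌋₊,
            (KMV2000.mollifierCoeff P (KMV2000.qhat q ^ Δ') m₁ : ℂ) *
              (KMV2000.mollifierCoeff P (KMV2000.qhat q ^ Δ') m₂ : ℂ) *
            ∑ d₁ ∈ m₁.divisors, ∑ d₂ ∈ m₂.divisors,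
              (((((m₁ / d₁).gcd (m₂ / d₂) : ℝ) * ((m₁ : ℝ) * m₂) ^ (-(1 / 2 : ℝ)) *
                (∫ u₁ in Set.Ioi (0 : ℝ),
                  (Real.log (KMV2000.qhat q / ((d₁ * (m₂ / d₂ / (m₁ / d₁).gcd (m₂ / d₂)) : ℕ) : ℝ)) + Real.log u₁) ^ i *
                  ∫ u₂ in Set.Ioi (((((m₁ / (m₁ / d₁).gcd (m₂ / d₂)) * (m₂ / (m₁ / d₁).gcd (m₂ / d₂)) : ℕ) : ℝ) /
                      KMV2000.qhat q ^ 2) / u₁),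
                    Real.exp (-(u₁ + u₂)) / (1 - Real.exp (-(u₁ + u₂))) ^ 2 *
                    (Real.log (KMV2000.qhat q / ((d₂ * (m₁ / d₁ / (m₁ / d₁).gcd (m₂ / d₂)) : ℕ) : ℝ)) + Real.log u₂) ^ j)) : ℝ) : ℂ) -
          ((2 * riemannZeta 2 ^ 2 *
              ((KMV2000.qhat q / (Δ' ^ 2 * Real.log (KMV2000.qhat q) ^ 2) : ℝ) : ℂ)) * ((τ i j Δ' P : ℝ) : ℂ)) =
      (((Real.log (KMV2000.qhat q))⁻¹ ^ (i + j) * KMV2000.qhat q *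
          (∑ m₁ ∈ Finset.Icc 1 ⌊KMV2000.qhat q ^ Δ'⌋₊, ∑ m₂ ∈ Finset.Icc 1 ⌊KMV2000.qhat q ^ Δ'⌋₊,
            KMV2000.mollifierCoeff P (KMV2000.qhat q ^ Δ') m₁ * KMV2000.mollifierCoeff P (KMV2000.qhat q ^ Δ') m₂ *
            ∑ d₁ ∈ m₁.divisors, ∑ d₂ ∈ m₂.divisors,
              ((m₁ / d₁).gcd (m₂ / d₂) : ℝ) * ((m₁ : ℝ) * m₂) ^ (-(1 / 2 : ℝ)) *
                ∫ u₁ in Set.Ioi (0 : ℝ),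
                  (Real.log (KMV2000.qhat q / ((d₁ * (m₂ / d₂ / (m₁ / d₁).gcd (m₂ / d₂)) : ℕ) : ℝ)) + Real.log u₁) ^ i *
                  ∫ u₂ in Set.Ioi (((((m₁ / (m₁ / d₁).gcd (m₂ / d₂)) * (m₂ / (m₁ / d₁).gcd (m₂ / d₂)) : ℕ) : ℝ) /
                      KMV2000.qhat q ^ 2) / u₁),
                    Real.exp (-(u₁ + u₂)) / (1 - Real.exp (-(u₁ + u₂))) ^ 2 *
                    (Real.log (KMV2000.qhat q / ((d₂ * (m₁ / d₁ / (m₁ / d₁).gcd (m₂ / d₂)) : ℕ) : ℝ)) + Real.log u₂) ^ j) -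
          2 * (π ^ 2 / 6) ^ 2 * (KMV2000.qhat q / (Δ' ^ 2 * Real.log (KMV2000.qhat q) ^ 2)) * τ i j Δ' P : ℝ) : ℂ) := by
    rw [riemannZeta_two]
    push_cast
    ring
  rw [hcast, Complex.norm_real, Real.norm_eq_abs, key]
  exact hq'

/-- **RUNG `N = 1`, UNCONDITIONAL**: for every admissible `P`, every `Q` with `natDegree Q ≤ 1` and every `Δ' ∈ (1, 3/2]`
there are `C, q₀` with `‖diagPart q P Q Δ' − 2ζ(2)² q̂/(Δ'²ℓ²)·(Q₀²·secondMomentForm Δ' P 1 + 2Q₁²·τ₁₁(Δ',P))‖ ≤ C q̂ ℓ⁻³`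
for all `q ≥ q₀` (`τ₁₁` as in the module docstring).
[cite: KowalskiMichelVanderKam2000, (23)–(28) pp. 13–15, Prop. 5.1 (31) — derivation (diagonal main term, Q of degree ≤ 1)] -/
theorem diagPart_asymp_of_natDegree_le_one {P Q : ℝ[X]} (hP : KMV2000.Admissible P) (hQ : Q.natDegree ≤ 1)
    {Δ' : ℝ} (h1 : 1 < Δ') (h32 : Δ' ≤ 3 / 2) :
    ∃ C : ℝ, ∃ q₀ : ℕ, ∀ (q : ℕ) [NeZero q], q₀ ≤ q →
      ‖diagPart q P Q Δ' -
          ((2 * riemannZeta 2 ^ 2 *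
              ((KMV2000.qhat q / (Δ' ^ 2 * Real.log (KMV2000.qhat q) ^ 2) : ℝ) : ℂ)) *
            ((Q.coeff 0 ^ 2 * KMV2000.secondMomentForm Δ' P 1 +
              2 * Q.coeff 1 ^ 2 *
                (Δ' ^ 2 * ((π ^ 2 / 6) ^ 2 *
              ((∑ j ∈ Finset.range (3 + 1), ∑ i ∈ Finset.range (j + 1),
                  ((3 : ℕ).choose j : ℝ) * (j.choose i : ℝ) * 2 ^ (3 - j) *
                    ∫ u in (0 : ℝ)..1, (((Polynomial.C (1 / Δ') - X) ^ (3 - j) *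
                      derivative (derivative (X ^ i * P))) * derivative (derivative (X ^ (j - i) * P))).eval u) / 24 -
                (∑ j ∈ Finset.range (1 + 1), ∑ i ∈ Finset.range (j + 1),
                  ((1 : ℕ).choose j : ℝ) * (j.choose i : ℝ) * 2 ^ (1 - j) *
                    ∫ u in (0 : ℝ)..1, (((Polynomial.C (1 / Δ') - X) ^ (1 - j) * (-(2 : ℝ) • (X ^ i * P))) *
                      derivative (derivative (X ^ (j - i) * P))).eval u) / 4)) / (2 * (π ^ 2 / 6) ^ 2)) : ℝ) : ℂ))‖ ≤
        C * KMV2000.qhat q * (Real.log (KMV2000.qhat q))⁻¹ ^ 3 := by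
  set τ : ℕ → ℕ → ℝ → ℝ[X] → ℝ := fun i j Δ' P ↦ if i = 0 ∧ j = 0 then KMV2000.secondMomentForm Δ' P 1 / 2 else
      (Δ' ^ 2 * ((π ^ 2 / 6) ^ 2 *
              ((∑ j ∈ Finset.range (3 + 1), ∑ i ∈ Finset.range (j + 1),
                  ((3 : ℕ).choose j : ℝ) * (j.choose i : ℝ) * 2 ^ (3 - j) *
                    ∫ u in (0 : ℝ)..1, (((Polynomial.C (1 / Δ') - X) ^ (3 - j) *
                      derivative (derivative (X ^ i * P))) * derivative (derivative (X ^ (j - i) * P))).eval u) / 24 -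
                (∑ j ∈ Finset.range (1 + 1), ∑ i ∈ Finset.range (j + 1),
                  ((1 : ℕ).choose j : ℝ) * (j.choose i : ℝ) * 2 ^ (1 - j) *
                    ∫ u in (0 : ℝ)..1, (((Polynomial.C (1 / Δ') - X) ^ (1 - j) * (-(2 : ℝ) • (X ^ i * P))) *
                      derivative (derivative (X ^ (j - i) * P))).eval u) / 4)) / (2 * (π ^ 2 / 6) ^ 2)) with hτ
  have t00 : ∀ (Δ' : ℝ) (P : ℝ[X]), τ 0 0 Δ' P = KMV2000.secondMomentForm Δ' P 1 / 2 := fun _ _ ↦ by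
    simp only [hτ, and_self, if_true]
  have t11 : ∀ (Δ' : ℝ) (P : ℝ[X]), τ 1 1 Δ' P =
      (Δ' ^ 2 * ((π ^ 2 / 6) ^ 2 *
              ((∑ j ∈ Finset.range (3 + 1), ∑ i ∈ Finset.range (j + 1),
                  ((3 : ℕ).choose j : ℝ) * (j.choose i : ℝ) * 2 ^ (3 - j) *
                    ∫ u in (0 : ℝ)..1, (((Polynomial.C (1 / Δ') - X) ^ (3 - j) *
                      derivative (derivative (X ^ i * P))) * derivative (derivative (X ^ (j - i) * P))).eval u) / 24 -
                (∑ j ∈ Finset.range (1 + 1), ∑ i ∈ Finset.range (j + 1),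
                  ((1 : ℕ).choose j : ℝ) * (j.choose i : ℝ) * 2 ^ (1 - j) *
                    ∫ u in (0 : ℝ)..1, (((Polynomial.C (1 / Δ') - X) ^ (1 - j) * (-(2 : ℝ) • (X ^ i * P))) *
                      derivative (derivative (X ^ (j - i) * P))).eval u) / 4)) / (2 * (π ^ 2 / 6) ^ 2)) := fun _ _ ↦ by
    simp only [hτ, one_ne_zero, and_self, if_false]
  obtain ⟨C, q₀, hC⟩ := diagPart_asymp_of_selbergOrderAsymptotics_le le_rfl 1 τ t00
    (fun i j hi hj hij h00 P' hP' Δ'' h1' h2' ↦ by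
      interval_cases i <;> interval_cases j
      · exact (h00 ⟨rfl, rfl⟩).elim
      · exact absurd hij (by decide)
      · exact absurd hij (by decide)
      · rw [t11]
        exact orderOneOne_target le_rfl P' hP' Δ'' h1' h2')
    hP hQ h1 h32
  refine ⟨C, q₀, fun q _ hq ↦ ?_⟩
  have h := hC q hq
  have key : (∑ i ∈ Finset.range (Q.natDegree + 1), ∑ j ∈ Finset.range (Q.natDegree + 1),
      Q.coeff i * Q.coeff j * (1 + (-1 : ℝ) ^ (i + j)) * τ i j Δ' P) =
      Q.coeff 0 ^ 2 * KMV2000.secondMomentForm Δ' P 1 + 2 * Q.coeff 1 ^ 2 * τ 1 1 Δ' P := by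
    rcases Nat.le_one_iff_eq_zero_or_eq_one.mp hQ with hdeg | hdeg
    · have hc1 : Q.coeff 1 = 0 := Polynomial.coeff_eq_zero_of_natDegree_lt (by omega)
      rw [hdeg, zero_add, Finset.sum_range_one, Finset.sum_range_one, t00, hc1]
      norm_num
      ring
    · rw [hdeg]
      simp only [Finset.sum_range_succ, Finset.sum_range_zero, zero_add, add_zero, pow_zero, pow_one, t00]
      norm_num
      ring
  rw [key, t11] at h
  exact h

end Summit.Parity.GeneralizedHardyLittlewood.Theorems.MomentsBeyondDiagonal.DiagLines

end
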